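import Summits.Ventures.HodgeRepro2.T5CyclotomicNineSextic

/-!
# `ℚ(ζ₉)`: THE SATAKE CHAIN OF THE RECORD'S PAIR AT THE PLACES ABOVE `2` (`q = 8`) AND `17` (`q = 17`), AS NUMERALS

Tier-5 support N3 / §G-N4.2 (seat p3, gen 80). File 283 reads the census of `ℚ(ζ₉)` — `2` stays prime with
`f(v/2) = 3`, `N(v) = 8`; `17` stays prime with `f(v/17) = 1`, `N(v) = 17`. File 282's theorem with `q = p^{f(v/p)}`
gives the Satake chain there, for every hermitian `H ∈ M₃(K)` with unit determinant good above `v`, every generator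
family `l` and every field `k` of characteristic `0`:

* **`exists_cells_ncard_and_three_term_record_two`** — `q = 8`: `deg Tₙ = 513 · 8^{4n−3}` (`deg T₁ = 4104`),
  `T₁ T_{n+2} = T_{n+3} + 7 T_{n+2} + 4096 T_{n+1}`, `T₁² = T₂ + 7 T₁ + 4104 T₀`;
* **`exists_cells_ncard_and_three_term_record_seventeen`** — `q = 17`: `deg Tₙ = 4914 · 17^{4n−3}`
  (`deg T₁ = 83538`), `T₁ T_{n+2} = T_{n+3} + 16 T_{n+2} + 83521 T_{n+1}`, `T₁² = T₂ + 16 T₁ + 83538 T₀`.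

Stated with the number-field and CM-field structures of `ℚ(ζ₉)` as instance variables (they exist: file 283's
`numberField_nine`, `isCMField_nine`), so that the hermitian/lattice vocabulary of files 251 / 282 elaborates without
`haveI` wrappers in the binders.

§8(d): uses an L-value-free non-vanishing device: NO.
-/

open Matrix NumberField NumberField.IsCMField IsDedekindDomain IsDedekindDomain.HeightOneSpectrum Module Polynomial
  MulAction
open scoped TensorProduct Pointwise
open Summit.Ventures.HodgeRepro2.T5UnitaryGroupForm Summit.Ventures.HodgeRepro2.T5UnitaryHeckeAdjoint
  Summit.Ventures.HodgeRepro2.T5HeckePermutationModule Summit.Ventures.HodgeRepro2.T5HeckeDoubleCoset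
  Summit.Ventures.HodgeRepro2.T5RecordHyperspecial Summit.Ventures.HodgeRepro2.T5GlobalLatticeAlmostAll
  Summit.Ventures.HodgeRepro2.T5FinitePlaceSplitClassification Summit.Ventures.HodgeRepro2.T5RecordSatakeIntrinsic
  Summit.Ventures.HodgeRepro2.T5CMFieldSquareDatum Summit.Ventures.HodgeRepro2.T5RecordSatakeToy
  Summit.Ventures.HodgeRepro2.T5SplitPlaceUnitaryGroup Summit.Ventures.HodgeRepro2.T5NonSplitPlaceUnitaryGroup
  Summit.Ventures.HodgeRepro2.T5FinitePlaceCM Summit.Ventures.HodgeRepro2.T5StarOfInvolution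
  Summit.Ventures.HodgeRepro2.T5RecordSatake Summit.Ventures.HodgeRepro2.T5RecordSatakeInert
  Summit.Ventures.HodgeRepro2.T5RecordSatakeInertToyDegree Summit.Ventures.HodgeRepro2.T5RecordSatakeDegreeCells
  Summit.Ventures.HodgeRepro2.T5CyclotomicSevenHeckeCommutative
  Summit.Ventures.HodgeRepro2.T5CMFieldCyclicGaloisCriterion Summit.Ventures.HodgeRepro2.T5SexticRecordSatake
  Summit.Ventures.HodgeRepro2.T5CyclotomicNineSextic

namespace Summit.Ventures.HodgeRepro2.T5CyclotomicNineSatake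

section Chain

variable (K : Type*) [Field K] [NumberField K] [IsCMField K] [IsCyclotomicExtension {9} ℚ K]

/-- **THE SATAKE CHAIN OF THE RECORD'S PAIR AT THE PLACES OF `ℚ(ζ₉)⁺` ABOVE `2`, `q = 8`**: cells `gₙ ∈ U(1 ⊗ H)` with
`deg Tₙ = 513 · 8^{4n−3}` (`n ≥ 1`), `deg T₀ = 1`, `T₁ T_{n+2} = T_{n+3} + 7 T_{n+2} + 4096 T_{n+1}` and
`T₁² = T₂ + 7 T₁ + 4104 T₀`, for every hermitian `H` with unit determinant good above `v`, every generator family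
`l` and every field `k` of characteristic `0` (file 282 with `f(v/2) = 3`). -/
theorem exists_cells_ncard_and_three_term_record_two (P : Ideal (𝓞 K)) [hP : P.IsPrime]
    [hPp : P.LiesOver (Ideal.span {(2 : ℤ)})]
    (v : HeightOneSpectrum (𝓞 (maximalRealSubfield K))) [hPv : P.LiesOver v.asIdeal]
    {r : ℕ} (l : Fin r → 𝓞 K) (k : Type*) [Field k] [CharZero k]
    (hl : Submodule.span (𝓞 (maximalRealSubfield K)) (Set.range l) = ⊤)
    {H : Matrix (Fin 3) (Fin 3) K} (hH : H.IsHermitian) (hdet : IsUnit H.det)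
    (hbad : ∀ w : HeightOneSpectrum (𝓞 K), w.asIdeal.LiesOver v.asIdeal → w ∉ badSet H) :
    ∃ g : ℕ → (letI := tensorStarRing K v; ↥(formUnitaryGroup (tensorGram K v H))),
      (∀ n, 1 ≤ n → (orbit (recordHyperspecial K v l H)
        (g n : _ ⧸ recordHyperspecial K v l H)).ncard = 513 * 8 ^ (4 * n - 3)) ∧
      (orbit (recordHyperspecial K v l H) (g 0 : _ ⧸ recordHyperspecial K v l H)).ncard = 1 ∧
      ∃ hfin : ∀ n, Finite (orbit (recordHyperspecial K v l H) (g n : _ ⧸ recordHyperspecial K v l H)),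
        (∀ n, letI := hfin 1; letI := hfin (n + 1 + 1); letI := hfin (n + 1 + 1 + 1); letI := hfin (n + 1);
          doubleCosetOp k (recordHyperspecial K v l H) (g 1) *
              doubleCosetOp k (recordHyperspecial K v l H) (g (n + 1 + 1)) =
            doubleCosetOp k (recordHyperspecial K v l H) (g (n + 1 + 1 + 1)) +
              (7 : k) • doubleCosetOp k (recordHyperspecial K v l H) (g (n + 1 + 1)) +
              (4096 : k) • doubleCosetOp k (recordHyperspecial K v l H) (g (n + 1))) ∧
        (letI := hfin 1; letI := hfin (0 + 1); letI := hfin (0 + 1 + 1); letI := hfin 0;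
          doubleCosetOp k (recordHyperspecial K v l H) (g 1) *
              doubleCosetOp k (recordHyperspecial K v l H) (g (0 + 1)) =
            doubleCosetOp k (recordHyperspecial K v l H) (g (0 + 1 + 1)) +
              (7 : k) • doubleCosetOp k (recordHyperspecial K v l H) (g (0 + 1)) +
              (4104 : k) • doubleCosetOp k (recordHyperspecial K v l H) (g 0)) := by
  haveI := isGalois_nine K
  haveI : Fact (Nat.Prime 2) := ⟨Nat.prime_two⟩
  haveI : v.asIdeal.LiesOver (Ideal.span {(2 : ℤ)}) := Ideal.LiesOver.tower_bot P v.asIdeal _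
  have hst := exists_map_eq_two K P v
  have hvf : v.asIdeal.inertiaDeg ℤ = 3 := hst.2.1
  have e1 : ((2 : ℕ) : k) ^ v.asIdeal.inertiaDeg ℤ - 1 = 7 := by
    rw [hvf]
    norm_num
  have e2 : (((2 : ℕ) : k) ^ v.asIdeal.inertiaDeg ℤ) ^ 4 = 4096 := by
    rw [hvf]
    norm_num
  have e3 : (((2 : ℕ) : k) ^ v.asIdeal.inertiaDeg ℤ) ^ 4 + ((2 : ℕ) : k) ^ v.asIdeal.inertiaDeg ℤ = 4104 := by
    rw [hvf]
    norm_num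
  refine hst.1.elim fun w hmap => ?_
  have key := T5SexticRecordSatake.exists_cells_ncard_and_three_term_record_of_map_eq K 2 v w hmap l k hl hH hdet
    (hbad w (liesOver_of_map_eq K v w hmap))
  refine key.elim fun g hg => ⟨g, fun n hn' => ?_, hg.2.1, ?_⟩
  · rw [hg.1 n hn', hvf]
    norm_num
  · refine hg.2.2.elim fun hfin hh => ⟨hfin, fun n => ?_, ?_⟩
    · exact three_term_congr e1 e2 (hh.1 n)
    · exact three_term_congr e1 e3 hh.2

/-- **THE SATAKE CHAIN OF THE RECORD'S PAIR AT THE PLACES OF `ℚ(ζ₉)⁺` ABOVE `17`, `q = 17`**: cells `gₙ ∈ U(1 ⊗ H)` with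
`deg Tₙ = 4914 · 17^{4n−3}` (`n ≥ 1`), `deg T₀ = 1`, `T₁ T_{n+2} = T_{n+3} + 16 T_{n+2} + 83521 T_{n+1}` and
`T₁² = T₂ + 16 T₁ + 83538 T₀`, for every hermitian `H` with unit determinant good above `v`, every generator family
`l` and every field `k` of characteristic `0` (file 282 with `f(v/17) = 1`). -/
theorem exists_cells_ncard_and_three_term_record_seventeen (P : Ideal (𝓞 K)) [hP : P.IsPrime]
    [hPp : P.LiesOver (Ideal.span {(17 : ℤ)})]
    (v : HeightOneSpectrum (𝓞 (maximalRealSubfield K))) [hPv : P.LiesOver v.asIdeal]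
    {r : ℕ} (l : Fin r → 𝓞 K) (k : Type*) [Field k] [CharZero k]
    (hl : Submodule.span (𝓞 (maximalRealSubfield K)) (Set.range l) = ⊤)
    {H : Matrix (Fin 3) (Fin 3) K} (hH : H.IsHermitian) (hdet : IsUnit H.det)
    (hbad : ∀ w : HeightOneSpectrum (𝓞 K), w.asIdeal.LiesOver v.asIdeal → w ∉ badSet H) :
    ∃ g : ℕ → (letI := tensorStarRing K v; ↥(formUnitaryGroup (tensorGram K v H))),
      (∀ n, 1 ≤ n → (orbit (recordHyperspecial K v l H)
        (g n : _ ⧸ recordHyperspecial K v l H)).ncard = 4914 * 17 ^ (4 * n - 3)) ∧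
      (orbit (recordHyperspecial K v l H) (g 0 : _ ⧸ recordHyperspecial K v l H)).ncard = 1 ∧
      ∃ hfin : ∀ n, Finite (orbit (recordHyperspecial K v l H) (g n : _ ⧸ recordHyperspecial K v l H)),
        (∀ n, letI := hfin 1; letI := hfin (n + 1 + 1); letI := hfin (n + 1 + 1 + 1); letI := hfin (n + 1);
          doubleCosetOp k (recordHyperspecial K v l H) (g 1) *
              doubleCosetOp k (recordHyperspecial K v l H) (g (n + 1 + 1)) =
            doubleCosetOp k (recordHyperspecial K v l H) (g (n + 1 + 1 + 1)) +
              (16 : k) • doubleCosetOp k (recordHyperspecial K v l H) (g (n + 1 + 1)) +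
              (83521 : k) • doubleCosetOp k (recordHyperspecial K v l H) (g (n + 1))) ∧
        (letI := hfin 1; letI := hfin (0 + 1); letI := hfin (0 + 1 + 1); letI := hfin 0;
          doubleCosetOp k (recordHyperspecial K v l H) (g 1) *
              doubleCosetOp k (recordHyperspecial K v l H) (g (0 + 1)) =
            doubleCosetOp k (recordHyperspecial K v l H) (g (0 + 1 + 1)) +
              (16 : k) • doubleCosetOp k (recordHyperspecial K v l H) (g (0 + 1)) +
              (83538 : k) • doubleCosetOp k (recordHyperspecial K v l H) (g 0)) := by
  haveI := isGalois_nine K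
  haveI : Fact (Nat.Prime 17) := ⟨by norm_num⟩
  haveI : v.asIdeal.LiesOver (Ideal.span {(17 : ℤ)}) := Ideal.LiesOver.tower_bot P v.asIdeal _
  have hst := exists_map_eq_seventeen K P v
  have hvf : v.asIdeal.inertiaDeg ℤ = 1 := hst.2.1
  have e1 : ((17 : ℕ) : k) ^ v.asIdeal.inertiaDeg ℤ - 1 = 16 := by
    rw [hvf]
    norm_num
  have e2 : (((17 : ℕ) : k) ^ v.asIdeal.inertiaDeg ℤ) ^ 4 = 83521 := by
    rw [hvf]
    norm_num
  have e3 : (((17 : ℕ) : k) ^ v.asIdeal.inertiaDeg ℤ) ^ 4 + ((17 : ℕ) : k) ^ v.asIdeal.inertiaDeg ℤ = 83538 := by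
    rw [hvf]
    norm_num
  refine hst.1.elim fun w hmap => ?_
  have key := T5SexticRecordSatake.exists_cells_ncard_and_three_term_record_of_map_eq K 17 v w hmap l k hl hH hdet
    (hbad w (liesOver_of_map_eq K v w hmap))
  refine key.elim fun g hg => ⟨g, fun n hn' => ?_, hg.2.1, ?_⟩
  · rw [hg.1 n hn', hvf]
    norm_num
  · refine hg.2.2.elim fun hfin hh => ⟨hfin, fun n => ?_, ?_⟩
    · exact three_term_congr e1 e2 (hh.1 n)
    · exact three_term_congr e1 e3 hh.2

end Chain

end Summit.Ventures.HodgeRepro2.T5CyclotomicNineSatake
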